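/-
Copyright: lit-balaban cell, reader/typer seat r01 (gen 51).  Released under Apache 2.0 license as described in the
file LICENSE.
-/
import Literature.MathematicalPhysics.QuantumFieldTheory.Balaban1983to89.B4Thm19ZeroLattice
import Literature.MathematicalPhysics.QuantumFieldTheory.Balaban1983to89.B4Lemma22ZeroBoxDerivDual
import Literature.Analysis.FunctionSpaces.RieszThorinKernel

/-!
# `Balaban1983to89.B4Lemma22ZeroLatticeDeriv` — [Balaban1983RegularityDecay] Lemma 2.2 p. 577–578 ∕ p. 583 FOR `□ ↦` THE WHOLE
# LATTICE `ηℤ^{d+1}`, `Ã = 0`, every dimension: (a) the exponentially WEIGHTED COLUMN bound of the differenced kernel of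
# `G_k(0)` — the print's (2.40)–(2.41) at `p₁ = ∞` for `G_k(0)∂^{η*}_μ`, i.e. `|(G_k(0)∂^{η*}_μf)(x)| ≤ c₀e^{−δ₀dist(x, supp f)/n}‖f‖_∞`
# (the lattice twin of `B4Lemma22ZeroBoxDerivDual.Gfine_colwD_bound` ∕ `lemma22_zero_box_Gdstar_dist`, in p03's infinite-volume
# limit); (b) the print's OWN route «duality … Riesz-Thorin» to the diagonal `q = p ∈ [1,∞[` of (2.17) for the two DERIVATIVE
# operators `∂^η_μG_k(0)`, `G_k(0)∂^{η*}_μ` (rows from `B4Thm19ZeroLattice`, columns from (a) and `G_k(0)(x,x′) = G_k(0)(x′,x)`,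
# `RieszThorinKernel.schur_riesz_thorin_counting`) — a second certificate, for complex data and with a `p₁`-free constant, of
# a range already covered by `B4Lemma22ZeroLatticeLpLq.GkLatD_lpq_le` ∕ `GkLatDadj_lpq_le` at `t = s` (Young ∕ Minkowski route)

statement-level skeleton of published theorems with citation tags; proofs where landed; nothing here is a claim about
the Yang–Mills mass gap

CITATION HEADER.  T. Bałaban, *Regularity and decay of lattice Green's functions*, Commun. Math. Phys. **89** (1983)
571–597, doi:10.1007/bf01214744 [Balaban1983RegularityDecay] (cell paper B4; held text
`paper:balaban1983-cmp89-regularity-decay`, journal page = PDF page + 570): p. 573 [PDF 3] (1.10) and the difference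
derivative `∂^η_μ`, p. 577–578 [PDF 7–8] Lemma 2.2 (2.16)–(2.17), p. 583 [PDF 13] the proof paragraph of (2.17), (2.40)–(2.41)
and the Remark, p. 584 [PDF 14] «valid for all such sets»; [Balaban1983Higgs3] p. 433 (the propagator `G_k(0)` on `ηℤ^{d+1}`).
Unit `lit-balaban-r01` gen 51 (row owner of block B4); HOME `run/shared/lean/pub/lit-balaban/`; SKELETON row **B4.Lem2.2**
(cells only, proved-headed).  Companion of p24's `B4Thm19ZeroLattice` ((1.9), the derivative clause of (1.10), (2.17) at the
corners `q = p = ∞` for `∂^η_μG_k(0)` and `q = p = 1` for `G_k(0)∂^{η*}_μ`), `B4Lemma22ZeroLattice` (the diagonal for `G_k(0)`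
itself, Schur route) and `B4Lemma22ZeroLatticeLpLq` (`1 ≤ p ≤ q < ∞`, `1/p − 1/q ≤ 1/p₁`, and `q = ∞`, `p ≥ p₁`, all three
operators — which INCLUDES the diagonals certified again here); imports the first, the box file `B4Lemma22ZeroBoxDerivDual`
and p04's `RieszThorinKernel`.

WHAT IS PRINTED.  p. 577–578, Lemma 2.2: «… and a constant c₂ depending on d, p₁, such that ‖G_k(□,Ã)f‖_q,
‖D^η_{Ã,μ}G_k(□,Ã)f‖_q, ‖G_k(□,Ã)D^{η*}_{Ã,μ}f‖_q ≦ c₂‖f‖_p (2.17) for 1 ≦ p, q ≦ ∞, satisfying the condition 1/p − 1/p₁ ≦ 1/q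
≦ 1/p with p₁ > d.»  p. 583: «Now we will prove the inequality (2.17) for G_k(□). For q = p = ∞, it is a special case of (2.16)
… For q = p = 1 we get it by duality argument, i.e. using the fact that the space L^∞(□) is adjoint to L¹(□). The Riesz-Thorin
Theorem implies it for arbitrary q = p from [1, ∞].» and «Now we will prove that the operators G_k(□), ∂^η_μG_k(□), G_k(□)∂^{η*}_μ
are bounded operators from L^{p₁}(□) with p₁ > d to L^∞(□). … Let us consider for example the operator G_k(□)∂^{η*}_μ: (2.40) …
|(G_k(□)∂^{η*}_μf)(x)| ≦ … Σ_y e^{−δ₀|(L^jη)^{−1}x−y|} … ≦ c′₂‖f‖_{p₁} (2.41)»; «Remark. … the above method can be used also to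
prove pointwise estimates of G_k(□), G_k(□,A), and even G_k(Ω,A), their derivatives …».  p. 584: «This part of the argument is
valid for an arbitrary rectangular parallelepiped □ built of unit blocks, so the inequalities are valid for all such sets.»

WHAT THIS MODULE PROVES (kernel-checked; theorems only; 0 `def`; 0 `sorry`; axioms standard), in the matrix units of the
zero-field lineage (`n = L^k` fine points per unit block, `∂^η_μ = n·(shift − 1)`, running `a_k`, window `a ∈ [a₋,a₊]`,
`m² ∈ [0,m²₊]`, `G_k(0) = B3GkZeroLattice.GkLat`; the kernel of `∂^η_μG_k(0)` is `K(x,z) = n(G_k(0)(x+e_μ,z) − G_k(0)(x,z))`, the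
kernel of `G_k(0)∂^{η*}_μ` is `K′(x,z) = n(G_k(0)(x,z+e_μ) − G_k(0)(x,z)) = K(z,x)`; the `η^{(d+1)/p}` of the `ℓ^p_η` norms cancel
between the two sides of (2.17) when `q = p`):
* §1 **THE WEIGHTED COLUMN BOUND (new on the lattice)**: `GkLat_weightedColD_le` — `δ₀, c₀ > 0` with
  `Σ_{x∈F}|n(G_k(0)(x′,x+e_μ) − G_k(0)(x′,x))|e^{δ₀|x′−x|_∞/n} ≤ c₀` for every `k ≥ 1`, window point, axis, site `x′` and finite
  `F` — the box bound `B4Lemma22ZeroBoxDerivDual.Gfine_colwD_bound` (p. 583 (2.40)–(2.41) with `‖f‖_∞`, uniform in the box) on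
  the centred cubes `C_t` in the limit `t → ∞` (`B3GkZeroLattice.tendsto_gcube`), exactly as `B4Thm19ZeroLattice.GkLat_weightedRowD_le`
  does for the rows; by `GkLat_comm` the same sums are the COLUMN sums of `K` (`GkLatD_weightedCol_le`).
* §2 **CORNERS IN THE (1.10) SHAPE**: `GkLat_adjDeriv_apply_le` (new on the lattice) — for bounded `f` of any support,
  `|(G_k(0)∂^{η*}_μf)(x)| ≤ c₀e^{−δ₀dist(x, supp f)/n}‖f‖_∞` with absolute convergence: (2.41) at `p₁ = ∞` with the decay of the
  Remark (lattice twin of `B4Lemma22ZeroBoxDerivDual.lemma22_zero_box_Gdstar_dist`; the tree's `B4Lemma22ZeroLatticeLpLq.GkLat_three_sup_le`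
  is the unweighted corner on finitely supported data); `GkLatD_apply_l1_le` — (2.17) at `q = p = 1` for `∂^η_μG_k(0)` as the
  column-sum statement, complex data (the real-data instance is also `GkLatD_lpq_le` at `t = s = 1`).
* §3 **THE PRINTED ROUTE TO THE DIAGONAL `q = p ∈ [1,∞[` FOR BOTH DERIVATIVE OPERATORS**: `GkLatD_apply_lp_le`,
  `GkLat_adjDeriv_apply_lp_le` — with `c₂ = max(c_row, c_col)` (independent of `p₁`), for every real `p ≥ 1`, finite data
  support `S`, output window `Λ` and complex `f`: `(Σ_{x∈Λ}|Σ_{z∈S}K(x,z)f(z)|^p)^{1/p} ≤ c₂(Σ_{z∈S}|f(z)|^p)^{1/p}` and the same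
  for `K′` (`schur_riesz_thorin_counting` on the truncation `Λ × S` — «by duality argument … The Riesz-Thorin Theorem implies it for
  arbitrary q = p»); series forms `GkLatD_apply_lp_tsum_le`, `GkLat_adjDeriv_apply_lp_tsum_le`.  A SECOND CERTIFICATE: this
  diagonal is already in the tree for real data in the η-weighted norms as the `t = s` instances of
  `B4Lemma22ZeroLatticeLpLq.GkLatD_lpq_le` ∕ `GkLatDadj_lpq_le` (b-lineage kernel-Young ∕ Minkowski route, constant depending on
  `p₁`); with `B4Thm19ZeroLattice` ∕ `B4Thm110ZeroLattice` (weighted corners), `B4Lemma22ZeroLattice` (`G_k(0)` diagonal) and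
  `B4Lemma22ZeroLatticeLpLq` the printed parallelogram `1/p − 1/p₁ ≤ 1/q ≤ 1/p` stands certified on the whole lattice at `Ã = 0`
  for all three operators by both routes.
* §4 non-vacuity (`d + 1 = 4`, `L = 2`, `a ∈ [1/2,2]`, `m² ∈ [0,1]`).

DICTIONARY / HONEST SCOPE.  (i) `Ã = 0`, one component, `□ ↦ ηℤ^{d+1}` (p. 584's «valid for all such sets» read for the whole
lattice through p03's infinite-volume limit of the box theorems); sup-norm distances in fine units; constants existential
(depending on `d`, `L`, the window).  (ii) NEW CONTENT is §1 and the decay form of §2 only; §3 re-proves, by the print's own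
route, statements the tree already holds through `B4Lemma22ZeroLatticeLpLq` — here the `(∞,∞)` input for `G_k(0)∂^{η*}_μ` is the
print's (2.40)–(2.41) at `p₁ = ∞` as landed on boxes (`Gfine_colwD_bound`), the `(1,1)` input for `∂^η_μG_k(0)` is its transpose
by the symmetry of `G_k(0)` (the content of «by duality»), and Riesz–Thorin is p04's Schur form.  (iii) `ℓ^p` statements on
finitely supported data ∕ finite output windows plus the series form (no `lp`-space packaging), as in the companions; the
decay statement of §2 for bounded data of arbitrary support.  (iv) Value = the (2.41)∕(1.10)-type decay of the third operator
`G_k(0)∂^{η*}_μ` and the weighted column sums of the differenced kernel for the free infinite-lattice propagator, plus a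
route-faithful second proof of the derivative diagonals; cells only, zero head weight; NOT summit progress.
-/

namespace Literature.MathematicalPhysics.QuantumFieldTheory.Balaban1983to89.B4Lemma22ZeroLatticeDeriv

open Finset Filter Topology Complex
open Literature.MathematicalPhysics.QuantumFieldTheory.Balaban1983to89.B4ContourShift (supNorm supNorm_nonneg)
open Literature.MathematicalPhysics.QuantumFieldTheory.Balaban1983to89.B4Reflection242
open Literature.MathematicalPhysics.QuantumFieldTheory.Balaban1983to89.B4BoxCov237
open Literature.MathematicalPhysics.QuantumFieldTheory.Balaban1983to89.B4Thm110ZeroBox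
open Literature.MathematicalPhysics.QuantumFieldTheory.Balaban1983to89.B4Thm110ZeroBoxDeriv
open Literature.MathematicalPhysics.QuantumFieldTheory.Balaban1983to89.B4Lemma22ZeroBoxDerivDual
  (fwd fwd_eq_of_nbr Gfine_colwD_bound)
open Literature.MathematicalPhysics.QuantumFieldTheory.Balaban1983to89.B4Thm19ZeroLattice (GkLat_weightedRowD_le)
open Literature.MathematicalPhysics.QuantumFieldTheory.Balaban1983to89.B3GkZeroLattice
open Literature.Analysis.FunctionSpaces.RieszThorin (schur_riesz_thorin_counting)

noncomputable section

variable {d : ℕ}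

/-! ## §0 Kernel helpers -/

/-- kernel: `L^k ≥ 1`. [folklore] -/
private theorem one_le_n (ℓ k : ℕ) : 1 ≤ (ℓ + 1) ^ k := Nat.one_le_pow _ _ (by omega)

/-- kernel: an injective relabelling of a finite partial sum of non-negative terms is dominated by the full finite sum.
[folklore] -/
private theorem sum_attach_le_univ_sum {α β : Type*} [Fintype β] [DecidableEq β] (F : Finset α) (ι : ↥F → β)
    (hι : Function.Injective ι) (g : β → ℝ) (hg : ∀ b, 0 ≤ g b) :
    ∑ a ∈ F.attach, g (ι a) ≤ ∑ b, g b := by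
  classical
  rw [← Finset.sum_image (f := g) (fun a _ b _ h => hι h)]
  exact Finset.sum_le_univ_sum_of_nonneg hg

/-- kernel: a common label radius for a finite set of points. [folklore] -/
private theorem exists_labRad_finset (n : ℕ) (F : Finset (Fin (d + 1) → ℤ)) :
    ∃ R : ℕ, ∀ x ∈ F, LabRad n R x := by
  refine ⟨∑ x ∈ F, ∑ i, (blk n x i).natAbs, fun x hx => (labRad_sum n x).mono ?_⟩
  exact Finset.single_le_sum (f := fun y => ∑ i, (blk n y i).natAbs) (fun _ _ => Nat.zero_le _) hx

/-- kernel: centring commutes with a lattice step. [folklore] -/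
private theorem ctr_add_single (n t : ℕ) (x : Fin (d + 1) → ℤ) (μ : Fin (d + 1)) :
    ctr n t (x + Pi.single μ 1) = ctr n t x + Pi.single μ 1 := by
  unfold ctr; exact add_right_comm _ _ _

/-- kernel: the centred points are injective in the point. [folklore] -/
private theorem ctr_injective (n t : ℕ) : Function.Injective (ctr (d := d) n t) :=
  fun _ _ h => add_left_injective _ h

/-- kernel: **a weighted-`ℓ¹` kernel row applied to a bounded function** — if `Σ_{z∈F}|K z|·e^{w z} ≤ c₀` for all finite `F`,
`‖f z‖ ≤ F_∞` and `E ≤ w z` on `supp f`, then `Σ_z K(z)f(z)` converges absolutely and `|Σ_z K(z)f(z)| ≤ c₀e^{−E}F_∞`. [folklore] -/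
private theorem tsum_mul_le_of_weighted {K w : (Fin (d + 1) → ℤ) → ℝ} {c₀ : ℝ}
    (hF : ∀ F : Finset (Fin (d + 1) → ℤ), ∑ z ∈ F, |K z| * Real.exp (w z) ≤ c₀)
    {f : (Fin (d + 1) → ℤ) → ℂ} {Fsup E : ℝ} (hf : ∀ z, ‖f z‖ ≤ Fsup) (hE : ∀ z, f z ≠ 0 → E ≤ w z) :
    (Summable fun z => ((K z : ℝ) : ℂ) * f z) ∧
      ‖∑' z, ((K z : ℝ) : ℂ) * f z‖ ≤ c₀ * Real.exp (-E) * Fsup := by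
  have hFsup : 0 ≤ Fsup := (norm_nonneg _).trans (hf 0)
  have hws : Summable fun z => |K z| * Real.exp (w z) :=
    summable_of_sum_le (fun _ => mul_nonneg (abs_nonneg _) (Real.exp_pos _).le) hF
  have hwt : ∑' z, |K z| * Real.exp (w z) ≤ c₀ :=
    Real.tsum_le_of_sum_le (fun _ => mul_nonneg (abs_nonneg _) (Real.exp_pos _).le) hF
  set g : (Fin (d + 1) → ℤ) → ℝ := fun z => Real.exp (-E) * Fsup * (|K z| * Real.exp (w z)) with hg
  have hmaj : ∀ z, ‖((K z : ℝ) : ℂ) * f z‖ ≤ g z := by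
    intro z
    by_cases hfz : f z = 0
    · rw [hfz, mul_zero, norm_zero, hg]
      exact mul_nonneg (mul_nonneg (Real.exp_pos _).le hFsup) (mul_nonneg (abs_nonneg _) (Real.exp_pos _).le)
    · rw [norm_mul, Complex.norm_real, Real.norm_eq_abs, hg]
      have hexp : (1 : ℝ) ≤ Real.exp (-E) * Real.exp (w z) := by
        rw [← Real.exp_add]
        exact Real.one_le_exp (by linarith [hE z hfz])
      calc |K z| * ‖f z‖ ≤ |K z| * Fsup := mul_le_mul_of_nonneg_left (hf z) (abs_nonneg _)
        _ = |K z| * Fsup * 1 := (mul_one _).symm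
        _ ≤ |K z| * Fsup * (Real.exp (-E) * Real.exp (w z)) :=
            mul_le_mul_of_nonneg_left hexp (mul_nonneg (abs_nonneg _) hFsup)
        _ = Real.exp (-E) * Fsup * (|K z| * Real.exp (w z)) := by ring
  have hgs : Summable g := hws.mul_left _
  refine ⟨Summable.of_norm_bounded hgs hmaj, (tsum_of_norm_bounded hgs.hasSum hmaj).trans ?_⟩
  rw [hg, tsum_mul_left]
  calc Real.exp (-E) * Fsup * ∑' z, |K z| * Real.exp (w z) ≤ Real.exp (-E) * Fsup * c₀ :=
        mul_le_mul_of_nonneg_left hwt (mul_nonneg (Real.exp_pos _).le hFsup)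
    _ = c₀ * Real.exp (-E) * Fsup := by ring

/-- kernel: a plain finite row sum is dominated by the exponentially weighted one (non-negative exponent). [folklore] -/
private theorem sum_abs_le_of_weighted {K w : (Fin (d + 1) → ℤ) → ℝ} {c₀ : ℝ} (hw : ∀ z, 0 ≤ w z)
    (hF : ∀ F : Finset (Fin (d + 1) → ℤ), ∑ z ∈ F, |K z| * Real.exp (w z) ≤ c₀) (F : Finset (Fin (d + 1) → ℤ)) :
    ∑ z ∈ F, |K z| ≤ c₀ :=
  (Finset.sum_le_sum fun z _ => le_mul_of_one_le_right (abs_nonneg _) (Real.one_le_exp (hw z))).trans (hF F)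

/-- kernel: … and the plain series converges with sum `≤ c₀`. [folklore] -/
private theorem summable_abs_of_weighted {K w : (Fin (d + 1) → ℤ) → ℝ} {c₀ : ℝ} (hw : ∀ z, 0 ≤ w z)
    (hF : ∀ F : Finset (Fin (d + 1) → ℤ), ∑ z ∈ F, |K z| * Real.exp (w z) ≤ c₀) :
    Summable (fun z => |K z|) ∧ ∑' z, |K z| ≤ c₀ :=
  ⟨summable_of_sum_le (fun _ => abs_nonneg _) (sum_abs_le_of_weighted hw hF),
    Real.tsum_le_of_sum_le (fun _ => abs_nonneg _) (sum_abs_le_of_weighted hw hF)⟩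

/-- kernel: the weight exponent of the lineage is non-negative. [folklore] -/
private theorem weight_nonneg {δ₀ : ℝ} (hδ₀ : 0 ≤ δ₀) (n : ℕ) (u : Fin (d + 1) → ℤ) :
    0 ≤ δ₀ * supNorm u / (n : ℝ) :=
  div_nonneg (mul_nonneg hδ₀ (supNorm_nonneg _)) (Nat.cast_nonneg _)

/-- kernel: **from finite-window `ℓ^p` bounds to the series form** — if `(Σ_{x∈Λ}g(x)^p)^{1/p} ≤ c·B^{1/p}` for every finite
window `Λ` (`g ≥ 0`, `c, B ≥ 0`, `p > 0`), then `Σ_x g(x)^p` converges and is `≤ c^p·B`. [folklore] -/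
private theorem lp_series_of_windows {g : (Fin (d + 1) → ℤ) → ℝ} (hg : ∀ x, 0 ≤ g x) {c B p : ℝ} (hc : 0 ≤ c)
    (hB : 0 ≤ B) (hp : 0 < p) (hwin : ∀ Λ : Finset (Fin (d + 1) → ℤ), (∑ x ∈ Λ, g x ^ p) ^ p⁻¹ ≤ c * B ^ p⁻¹) :
    (Summable fun x => g x ^ p) ∧ ∑' x, g x ^ p ≤ c ^ p * B := by
  have hwin' : ∀ Λ : Finset (Fin (d + 1) → ℤ), ∑ x ∈ Λ, g x ^ p ≤ c ^ p * B := by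
    intro Λ
    set A : ℝ := ∑ x ∈ Λ, g x ^ p with hA
    have hA0 : 0 ≤ A := Finset.sum_nonneg fun _ _ => Real.rpow_nonneg (hg _) _
    have h2 := Real.rpow_le_rpow (Real.rpow_nonneg hA0 _) (hwin Λ) hp.le
    rw [Real.rpow_inv_rpow hA0 hp.ne', Real.mul_rpow hc (Real.rpow_nonneg hB _),
      Real.rpow_inv_rpow hB hp.ne'] at h2
    exact h2
  exact ⟨summable_of_sum_le (fun _ => Real.rpow_nonneg (hg _) _) hwin',
    Real.tsum_le_of_sum_le (fun _ => Real.rpow_nonneg (hg _) _) hwin'⟩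

/-! ## §1 The weighted COLUMN bound for the differenced kernel of `G_k(0)` on `ηℤ^{d+1}` -/

/-- **THE UNIFORM WEIGHTED BOUND FOR THE COLUMN-DIFFERENCED KERNEL OF `G_k(0)`, `Ω = ηℤ^{d+1}`, `A = 0`, finite partial
sums.**  There are `δ₀, c₀ > 0` (depending on `d`, `L = ℓ + 1` and the window only) such that for every `k ≥ 1`,
`a ∈ [a₋,a₊]`, `m² ∈ [0,m²₊]`, every axis `μ`, site `x′` and finite `F ⊂ ℤ^{d+1}`:
`Σ_{x∈F} |n·(G_k(0)(x′,x+e_μ) − G_k(0)(x′,x))|·e^{δ₀|x′−x|_∞/n} ≤ c₀` (`n = L^k`) — these are the weighted row sums of the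
kernel of `G_k(0)∂^{η*}_μ`; the box theorem `B4Lemma22ZeroBoxDerivDual.Gfine_colwD_bound` ((2.40)–(2.41) with `‖f‖_∞`,
uniform in the box) on the centred cubes `C_t`, in the limit `t → ∞` (`B3GkZeroLattice.tendsto_gcube`).
[cite: Balaban1983RegularityDecay, Lemma 2.2 (2.17) p.578 (third operator, q = p = ∞); proof p.583 (2.40)–(2.41); dictionary (□ ↦ ηℤ^{d+1}, Ã = 0)] -/
theorem GkLat_weightedColD_le (d ℓ : ℕ) (hℓ : 1 ≤ ℓ) (amin aplus m2plus : ℝ) (ha : 0 < amin) :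
    ∃ δ₀ c₀ : ℝ, 0 < δ₀ ∧ 0 < c₀ ∧ ∀ (k : ℕ), 1 ≤ k → ∀ (a m2 : ℝ), amin ≤ a → a ≤ aplus → 0 ≤ m2 → m2 ≤ m2plus →
      ∀ (μ : Fin (d + 1)) (x' : Fin (d + 1) → ℤ) (F : Finset (Fin (d + 1) → ℤ)),
        ∑ x ∈ F, |(((ℓ + 1) ^ k : ℕ) : ℝ) * (GkLat ℓ k a m2 x' (x + Pi.single μ 1) - GkLat ℓ k a m2 x' x)|
            * Real.exp (δ₀ * supNorm (x' - x) / (((ℓ + 1) ^ k : ℕ) : ℝ)) ≤ c₀ := by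
  obtain ⟨δ₀, c₀, hδ₀, hc₀, h⟩ := Gfine_colwD_bound d ℓ hℓ amin aplus m2plus ha
  refine ⟨δ₀, c₀, hδ₀, hc₀, ?_⟩
  intro k hk a m2 h1 h2 h3 h4 μ x' F
  have hn := one_le_n ℓ k
  have ha' : 0 < a := ha.trans_le h1
  obtain ⟨R, hR⟩ := exists_labRad_finset ((ℓ + 1) ^ k)
    (insert x' (F ∪ F.image (fun x => x + Pi.single μ 1)))
  have hx'R : LabRad ((ℓ + 1) ^ k) R x' := hR x' (Finset.mem_insert_self _ _)
  have hFR : ∀ x ∈ F, LabRad ((ℓ + 1) ^ k) R x :=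
    fun x hx => hR x (Finset.mem_insert_of_mem (Finset.mem_union_left _ hx))
  have hFeR : ∀ x ∈ F, LabRad ((ℓ + 1) ^ k) R (x + Pi.single μ 1) :=
    fun x hx => hR (x + Pi.single μ 1)
      (Finset.mem_insert_of_mem (Finset.mem_union_right _ (Finset.mem_image_of_mem (fun x => x + Pi.single μ 1) hx)))
  have hB : ∀ t, R ≤ t →
      ∑ x ∈ F, |(((ℓ + 1) ^ k : ℕ) : ℝ) * (gcube ℓ k t a m2 x' (x + Pi.single μ 1) - gcube ℓ k t a m2 x' x)|
        * Real.exp (δ₀ * supNorm (x' - x) / (((ℓ + 1) ^ k : ℕ) : ℝ)) ≤ c₀ := by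
    intro t ht
    have hx'm := ctr_mem (d := d) hn ht hx'R
    have hFm : ∀ x ∈ F, ctr ((ℓ + 1) ^ k) t x ∈ boxDom (Nf ℓ k (cubeM (d := d) t)) :=
      fun x hx => ctr_mem (d := d) hn ht (hFR x hx)
    have hFem : ∀ x ∈ F, ctr ((ℓ + 1) ^ k) t (x + Pi.single μ 1) ∈ boxDom (Nf ℓ k (cubeM (d := d) t)) :=
      fun x hx => ctr_mem (d := d) hn ht (hFeR x hx)
    set G := Gfine ℓ k (cubeM (d := d) t) k a m2 with hG
    set g : ↥(boxDom (Nf ℓ k (cubeM (d := d) t))) → ℝ := fun y =>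
      |(((ℓ + 1) ^ k : ℕ) : ℝ) * (G ⟨_, hx'm⟩ (fwd (Nf ℓ k (cubeM (d := d) t)) μ y) - G ⟨_, hx'm⟩ y)|
        * Real.exp (δ₀ * supNorm (ctr ((ℓ + 1) ^ k) t x' - y.1) / (((ℓ + 1) ^ k : ℕ) : ℝ)) with hg
    have hcolw : ∑ y, g y ≤ c₀ := by
      have := h k hk k hk le_rfl a m2 h1 h2 h3 h4 (cubeM t) (cubeM_pos t) μ ⟨_, hx'm⟩
      simpa only [wsum, hg] using this
    set ι : ↥F → ↥(boxDom (Nf ℓ k (cubeM (d := d) t))) := fun y => ⟨ctr ((ℓ + 1) ^ k) t y.1, hFm y.1 y.2⟩ with hι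
    have hinj : Function.Injective ι := fun y₁ y₂ hy =>
      Subtype.ext (ctr_injective _ _ (congrArg Subtype.val hy))
    -- on the centred points of `F` the forward neighbour of the box is the true lattice neighbour
    have hfwd : ∀ y : ↥F, fwd (Nf ℓ k (cubeM (d := d) t)) μ ⟨ctr ((ℓ + 1) ^ k) t y.1, hFm y.1 y.2⟩
        = ⟨ctr ((ℓ + 1) ^ k) t (y.1 + Pi.single μ 1), hFem y.1 y.2⟩ :=
      fun y => fwd_eq_of_nbr μ _ _ (ctr_add_single _ _ _ _)
    have hsum : ∑ x ∈ F, |(((ℓ + 1) ^ k : ℕ) : ℝ) * (gcube ℓ k t a m2 x' (x + Pi.single μ 1) - gcube ℓ k t a m2 x' x)|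
        * Real.exp (δ₀ * supNorm (x' - x) / (((ℓ + 1) ^ k : ℕ) : ℝ)) = ∑ y ∈ F.attach, g (ι y) := by
      rw [← Finset.sum_attach]
      refine Finset.sum_congr rfl fun y _ => ?_
      simp only [hg, hι, hfwd y, gcube_eq hx'm (hFem y.1 y.2), gcube_eq hx'm (hFm y.1 y.2), ctr_sub_ctr, hG]
    rw [hsum]
    exact (sum_attach_le_univ_sum F ι hinj g fun y => mul_nonneg (abs_nonneg _) (Real.exp_pos _).le).trans hcolw
  have hlim : Tendsto (fun t => ∑ x ∈ F, |(((ℓ + 1) ^ k : ℕ) : ℝ) *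
        (gcube ℓ k t a m2 x' (x + Pi.single μ 1) - gcube ℓ k t a m2 x' x)|
      * Real.exp (δ₀ * supNorm (x' - x) / (((ℓ + 1) ^ k : ℕ) : ℝ))) atTop
      (𝓝 (∑ x ∈ F, |(((ℓ + 1) ^ k : ℕ) : ℝ) * (GkLat ℓ k a m2 x' (x + Pi.single μ 1) - GkLat ℓ k a m2 x' x)|
        * Real.exp (δ₀ * supNorm (x' - x) / (((ℓ + 1) ^ k : ℕ) : ℝ)))) :=
    tendsto_finsetSum F fun x _ =>
      ((((tendsto_gcube hℓ hk ha' h3 x' (x + Pi.single μ 1)).sub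
        (tendsto_gcube hℓ hk ha' h3 x' x)).const_mul _).abs).mul_const _
  exact le_of_tendsto hlim (eventually_atTop.2 ⟨R, hB⟩)

/-- **THE COLUMN SUMS OF THE KERNEL OF `∂^η_μG_k(0)`** («by duality argument», p. 583 — here the symmetry
`G_k(0)(x,z) = G_k(0)(z,x)`, `B3GkZeroLattice.GkLat_comm`): with the constants of `GkLat_weightedColD_le`, for every column `x′`
and finite `F`: `Σ_{x∈F} |n·(G_k(0)(x+e_μ,x′) − G_k(0)(x,x′))|·e^{δ₀|x−x′|_∞/n} ≤ c₀`.
[cite: Balaban1983RegularityDecay, Lemma 2.2 (2.17) p.578 (second operator, q = p = 1); proof p.583; dictionary (□ ↦ ηℤ^{d+1}, Ã = 0)] -/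
theorem GkLatD_weightedCol_le (d ℓ : ℕ) (hℓ : 1 ≤ ℓ) (amin aplus m2plus : ℝ) (ha : 0 < amin) :
    ∃ δ₀ c₀ : ℝ, 0 < δ₀ ∧ 0 < c₀ ∧ ∀ (k : ℕ), 1 ≤ k → ∀ (a m2 : ℝ), amin ≤ a → a ≤ aplus → 0 ≤ m2 → m2 ≤ m2plus →
      ∀ (μ : Fin (d + 1)) (x' : Fin (d + 1) → ℤ) (F : Finset (Fin (d + 1) → ℤ)),
        ∑ x ∈ F, |(((ℓ + 1) ^ k : ℕ) : ℝ) * (GkLat ℓ k a m2 (x + Pi.single μ 1) x' - GkLat ℓ k a m2 x x')|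
            * Real.exp (δ₀ * supNorm (x - x') / (((ℓ + 1) ^ k : ℕ) : ℝ)) ≤ c₀ := by
  obtain ⟨δ₀, c₀, hδ₀, hc₀, h⟩ := GkLat_weightedColD_le d ℓ hℓ amin aplus m2plus ha
  refine ⟨δ₀, c₀, hδ₀, hc₀, fun k hk a m2 h1 h2 h3 h4 μ x' F => ?_⟩
  refine le_of_eq_of_le (Finset.sum_congr rfl fun x _ => ?_) (h k hk a m2 h1 h2 h3 h4 μ x' F)
  rw [GkLat_comm (x + Pi.single μ 1) x', GkLat_comm x x', ← B4TorusKernel.supNorm_neg (x - x'), neg_sub]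

/-! ## §2 The corners in the (1.10) shape: `q = p = 1` for `∂^η_μG_k(0)`, `q = p = ∞` with decay for `G_k(0)∂^{η*}_μ` -/

section Corners

variable {ℓ k : ℕ} {a m2 δ₀ c₀ : ℝ} {μ : Fin (d + 1)}

/-- **(2.17) AT `q = p = 1` FOR `∂^η_μG_k(0)` ON `ηℤ^{d+1}`, complex data**: with the constants of `GkLatD_weightedCol_le`, for
every finitely supported `f` (support in `S`): `Σ_x |Σ_{z∈S} n(G_k(0)(x+e_μ,z) − G_k(0)(x,z))·f(z)| ≤ c₀·Σ_{z∈S}|f(z)|`, i.e.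
`‖∂^η_μG_k(0)f‖_1 ≤ c₀‖f‖_1` (the common factor `η^{d+1}` of the two `L¹` norms cancels) — the column sums of the kernel are
`≤ c₀` (the real-data instance is also `B4Lemma22ZeroLatticeLpLq.GkLatD_lpq_le` at `t = s = 1`).
[cite: Balaban1983RegularityDecay, Lemma 2.2 (2.17) p.578 (second operator); proof p.583 («by duality argument»); dictionary (□ ↦ ηℤ^{d+1}, Ã = 0)] -/
theorem GkLatD_apply_l1_le (hδ₀ : 0 ≤ δ₀)
    (hF : ∀ (x' : Fin (d + 1) → ℤ) (F : Finset (Fin (d + 1) → ℤ)),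
      ∑ x ∈ F, |(((ℓ + 1) ^ k : ℕ) : ℝ) * (GkLat ℓ k a m2 (x + Pi.single μ 1) x' - GkLat ℓ k a m2 x x')|
        * Real.exp (δ₀ * supNorm (x - x') / (((ℓ + 1) ^ k : ℕ) : ℝ)) ≤ c₀)
    (S : Finset (Fin (d + 1) → ℤ)) (f : (Fin (d + 1) → ℤ) → ℂ) :
    (Summable fun x => ‖∑ z ∈ S, (((((ℓ + 1) ^ k : ℕ) : ℝ) *
        (GkLat ℓ k a m2 (x + Pi.single μ 1) z - GkLat ℓ k a m2 x z) : ℝ) : ℂ) * f z‖) ∧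
      ∑' x, ‖∑ z ∈ S, (((((ℓ + 1) ^ k : ℕ) : ℝ) *
        (GkLat ℓ k a m2 (x + Pi.single μ 1) z - GkLat ℓ k a m2 x z) : ℝ) : ℂ) * f z‖
        ≤ c₀ * ∑ z ∈ S, ‖f z‖ := by
  set K : (Fin (d + 1) → ℤ) → (Fin (d + 1) → ℤ) → ℝ := fun z x =>
    (((ℓ + 1) ^ k : ℕ) : ℝ) * (GkLat ℓ k a m2 (x + Pi.single μ 1) z - GkLat ℓ k a m2 x z) with hKdef
  -- the columns of the differenced kernel are summable with sum `≤ c₀`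
  have hcol : ∀ z, Summable (fun x => |K z x|) ∧ ∑' x, |K z x| ≤ c₀ := fun z =>
    summable_abs_of_weighted (fun x => weight_nonneg hδ₀ _ (x - z)) (hF z)
  set g : (Fin (d + 1) → ℤ) → ℝ := fun x => ∑ z ∈ S, |K z x| * ‖f z‖ with hg
  have hgs : Summable g := summable_sum fun z _ => (hcol z).1.mul_right _
  have hmaj : ∀ x, ‖∑ z ∈ S, ((K z x : ℝ) : ℂ) * f z‖ ≤ g x := by
    intro x
    refine (norm_sum_le _ _).trans (le_of_eq (Finset.sum_congr rfl fun z _ => ?_))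
    rw [norm_mul, Complex.norm_real, Real.norm_eq_abs]
  refine ⟨Summable.of_nonneg_of_le (fun _ => norm_nonneg _) hmaj hgs, ?_⟩
  refine (Summable.tsum_le_tsum hmaj (Summable.of_nonneg_of_le (fun _ => norm_nonneg _) hmaj hgs) hgs).trans ?_
  rw [hg, Summable.tsum_finsetSum (fun z _ => (hcol z).1.mul_right _), Finset.mul_sum]
  refine Finset.sum_le_sum fun z _ => ?_
  rw [tsum_mul_right]
  exact mul_le_mul_of_nonneg_right (hcol z).2 (norm_nonneg _)

variable {x : Fin (d + 1) → ℤ}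

/-- **(2.17) AT `q = p = ∞` FOR `G_k(0)∂^{η*}_μ` ON `ηℤ^{d+1}`, WITH THE DECAY OF (2.41) ∕ THE REMARK OF p. 583** (bounded data
of arbitrary support): with the constants of `GkLat_weightedColD_le`, for every bounded `f : ηℤ^{d+1} → ℂ` (`‖f(z)‖ ≤ F_∞`) and
every `D ≤ |x − z|_∞` on `supp f`, the series `(G_k(0)∂^{η*}_μf)(x) = Σ_z n(G_k(0)(x,z+e_μ) − G_k(0)(x,z))f(z)` converges
absolutely and `|(G_k(0)∂^{η*}_μf)(x)| ≤ c₀·e^{−δ₀D/n}·F_∞` (`D = 0`: `‖G_k(0)∂^{η*}_μf‖_∞ ≤ c₀‖f‖_∞`; lattice twin of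
`B4Lemma22ZeroBoxDerivDual.lemma22_zero_box_Gdstar_dist`; the unweighted corner on finitely supported data is also
`B4Lemma22ZeroLatticeLpLq.GkLat_three_sup_le`).
[cite: Balaban1983RegularityDecay, Lemma 2.2 (2.17) p.578 (third operator); proof p.583 (2.40)–(2.41) and Remark; dictionary (□ ↦ ηℤ^{d+1}, Ã = 0, sup-norm distance in units of η)] -/
theorem GkLat_adjDeriv_apply_le
    (hF : ∀ F : Finset (Fin (d + 1) → ℤ),
      ∑ z ∈ F, |(((ℓ + 1) ^ k : ℕ) : ℝ) * (GkLat ℓ k a m2 x (z + Pi.single μ 1) - GkLat ℓ k a m2 x z)|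
        * Real.exp (δ₀ * supNorm (x - z) / (((ℓ + 1) ^ k : ℕ) : ℝ)) ≤ c₀)
    (hδ₀ : 0 ≤ δ₀) {f : (Fin (d + 1) → ℤ) → ℂ} {Fsup D : ℝ} (hf : ∀ z, ‖f z‖ ≤ Fsup)
    (hD : ∀ z, f z ≠ 0 → D ≤ supNorm (x - z)) :
    (Summable fun z =>
        (((((ℓ + 1) ^ k : ℕ) : ℝ) * (GkLat ℓ k a m2 x (z + Pi.single μ 1) - GkLat ℓ k a m2 x z) : ℝ) : ℂ) * f z) ∧
      ‖∑' z, (((((ℓ + 1) ^ k : ℕ) : ℝ) * (GkLat ℓ k a m2 x (z + Pi.single μ 1) - GkLat ℓ k a m2 x z) : ℝ) : ℂ) * f z‖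
        ≤ c₀ * Real.exp (-(δ₀ * D / (((ℓ + 1) ^ k : ℕ) : ℝ))) * Fsup :=
  tsum_mul_le_of_weighted hF hf fun z hz =>
    div_le_div_of_nonneg_right (mul_le_mul_of_nonneg_left (hD z hz) hδ₀) (Nat.cast_nonneg _)

end Corners

/-! ## §3 The printed route to (2.17), `q = p ∈ [1,∞[`, for `∂^η_μG_k(0)` and `G_k(0)∂^{η*}_μ` on `ηℤ^{d+1}`

A second certificate (duality + Riesz–Thorin, complex data, `p₁`-free constant) of the diagonal that
`B4Lemma22ZeroLatticeLpLq.GkLatD_lpq_le` ∕ `GkLatDadj_lpq_le` already give at `t = s` by the kernel-Young ∕ Minkowski route. -/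

/-- **LEMMA 2.2 (2.17) ON THE DIAGONAL `q = p ∈ [1,∞[` FOR `∂^η_μG_k(0)`, `□ ↦ ηℤ^{d+1}`, `Ã = 0`, BY THE PRINTED ROUTE** (finite
truncations): there is `c₂ > 0` (on `d`, `L`, the window: the larger of the row constant of
`B4Thm19ZeroLattice.GkLat_weightedRowD_le` and the column constant of `GkLatD_weightedCol_le`) such that for every `k ≥ 1`,
`a ∈ [a₋,a₊]`, `m² ∈ [0,m²₊]`, real `p ≥ 1`, axis `μ`, finite `S` (support of the data), finite output window `Λ` and every
complex `f`: `(Σ_{x∈Λ}|Σ_{z∈S} n(G_k(0)(x+e_μ,z) − G_k(0)(x,z))f(z)|^p)^{1/p} ≤ c₂·(Σ_{z∈S}|f(z)|^p)^{1/p}` — «For q = p = 1 we get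
it by duality argument … The Riesz-Thorin Theorem implies it for arbitrary q = p from [1, ∞]» (`schur_riesz_thorin_counting` on
`Λ × S`, constant `c₂^{1−1/p}c₂^{1/p} = c₂`; the real-data statement in η-weighted norms is also `GkLatD_lpq_le` at `t = s`).
[cite: Balaban1983RegularityDecay, Lemma 2.2 (2.17) p.578 (second operator); proof p.583; dictionary (□ ↦ ηℤ^{d+1}, Ã = 0)] -/
theorem GkLatD_apply_lp_le (d ℓ : ℕ) (hℓ : 1 ≤ ℓ) (amin aplus m2plus : ℝ) (ha : 0 < amin) :
    ∃ c₂ : ℝ, 0 < c₂ ∧ ∀ (k : ℕ), 1 ≤ k → ∀ (a m2 : ℝ), amin ≤ a → a ≤ aplus → 0 ≤ m2 → m2 ≤ m2plus →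
      ∀ (p : ℝ), 1 ≤ p → ∀ (μ : Fin (d + 1)) (S Λ : Finset (Fin (d + 1) → ℤ)) (f : (Fin (d + 1) → ℤ) → ℂ),
        (∑ x ∈ Λ, ‖∑ z ∈ S, (((((ℓ + 1) ^ k : ℕ) : ℝ) *
            (GkLat ℓ k a m2 (x + Pi.single μ 1) z - GkLat ℓ k a m2 x z) : ℝ) : ℂ) * f z‖ ^ p) ^ p⁻¹
          ≤ c₂ * (∑ z ∈ S, ‖f z‖ ^ p) ^ p⁻¹ := by
  classical
  obtain ⟨δr, cr, hδr, hcr, hrow0⟩ := GkLat_weightedRowD_le d ℓ hℓ amin aplus m2plus ha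
  obtain ⟨δc, cc, hδc, hcc, hcol0⟩ := GkLatD_weightedCol_le d ℓ hℓ amin aplus m2plus ha
  refine ⟨max cr cc, lt_max_of_lt_left hcr, ?_⟩
  intro k hk a m2 h1 h2 h3 h4 p hp μ S Λ f
  set c₂ : ℝ := max cr cc with hc₂
  have hc₂0 : 0 < c₂ := lt_max_of_lt_left hcr
  set Kf : (Fin (d + 1) → ℤ) → (Fin (d + 1) → ℤ) → ℝ := fun x z =>
    (((ℓ + 1) ^ k : ℕ) : ℝ) * (GkLat ℓ k a m2 (x + Pi.single μ 1) z - GkLat ℓ k a m2 x z) with hKf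
  have hrowF : ∀ (x : Fin (d + 1) → ℤ) (F : Finset (Fin (d + 1) → ℤ)), ∑ z ∈ F, |Kf x z| ≤ c₂ :=
    fun x F => (sum_abs_le_of_weighted (fun z => weight_nonneg hδr.le _ (x - z))
      (hrow0 k hk a m2 h1 h2 h3 h4 μ x) F).trans (le_max_left _ _)
  have hcolF : ∀ (z : Fin (d + 1) → ℤ) (F : Finset (Fin (d + 1) → ℤ)), ∑ x ∈ F, |Kf x z| ≤ c₂ :=
    fun z F => (sum_abs_le_of_weighted (fun x => weight_nonneg hδc.le _ (x - z))
      (hcol0 k hk a m2 h1 h2 h3 h4 μ z) F).trans (le_max_right _ _)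
  -- the truncated kernel on `Λ × S`
  set K : ↥Λ → ↥S → ℂ := fun x z => ((Kf x.1 z.1 : ℝ) : ℂ) with hK
  have hrow : ∀ x : ↥Λ, ∑ z : ↥S, ‖K x z‖ ≤ c₂ := by
    intro x
    have := hrowF x.1 S
    rw [← Finset.sum_coe_sort S] at this
    simpa only [hK, Complex.norm_real, Real.norm_eq_abs] using this
  have hcol : ∀ z : ↥S, ∑ x : ↥Λ, ‖K x z‖ ≤ c₂ := by
    intro z
    have := hcolF z.1 Λ
    rw [← Finset.sum_coe_sort Λ] at this
    simpa only [hK, Complex.norm_real, Real.norm_eq_abs] using this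
  have H := schur_riesz_thorin_counting hc₂0.le hc₂0.le hrow hcol hp (fun z : ↥S => f z.1)
  have hcc' : c₂ ^ (1 - p⁻¹) * c₂ ^ p⁻¹ = c₂ := by
    rw [← Real.rpow_add hc₂0, sub_add_cancel, Real.rpow_one]
  rw [hcc'] at H
  have hL : (∑ x : ↥Λ, ‖∑ z : ↥S, K x z * f z.1‖ ^ p)
      = ∑ x ∈ Λ, ‖∑ z ∈ S, ((Kf x z : ℝ) : ℂ) * f z‖ ^ p := by
    rw [← Finset.sum_coe_sort Λ]
    refine Finset.sum_congr rfl fun x _ => ?_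
    rw [← Finset.sum_coe_sort S]
  have hR : (∑ z : ↥S, ‖f z.1‖ ^ p) = ∑ z ∈ S, ‖f z‖ ^ p := by
    rw [← Finset.sum_coe_sort S]
  rw [hL, hR] at H
  exact H

/-- **(2.17), `q = p`, FOR `∂^η_μG_k(0)`, SERIES FORM**: `Σ_{x∈ℤ^{d+1}}|(∂^η_μG_k(0)f)(x)|^p ≤ c₂^p·Σ_z|f(z)|^p` for finitely
supported `f` — i.e. `‖∂^η_μG_k(0)f‖_{ℓ^p} ≤ c₂‖f‖_{ℓ^p}`, `1 ≤ p < ∞` (the finite-window bound of `GkLatD_apply_lp_le` for every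
window; `p = ∞` is `B4Thm19ZeroLattice.GkLatD_apply_le`).
[cite: Balaban1983RegularityDecay, Lemma 2.2 (2.17) p.578 (second operator); proof p.583; dictionary (□ ↦ ηℤ^{d+1}, Ã = 0)] -/
theorem GkLatD_apply_lp_tsum_le (d ℓ : ℕ) (hℓ : 1 ≤ ℓ) (amin aplus m2plus : ℝ) (ha : 0 < amin) :
    ∃ c₂ : ℝ, 0 < c₂ ∧ ∀ (k : ℕ), 1 ≤ k → ∀ (a m2 : ℝ), amin ≤ a → a ≤ aplus → 0 ≤ m2 → m2 ≤ m2plus →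
      ∀ (p : ℝ), 1 ≤ p → ∀ (μ : Fin (d + 1)) (S : Finset (Fin (d + 1) → ℤ)) (f : (Fin (d + 1) → ℤ) → ℂ),
        (Summable fun x => ‖∑ z ∈ S, (((((ℓ + 1) ^ k : ℕ) : ℝ) *
            (GkLat ℓ k a m2 (x + Pi.single μ 1) z - GkLat ℓ k a m2 x z) : ℝ) : ℂ) * f z‖ ^ p) ∧
        ∑' x, ‖∑ z ∈ S, (((((ℓ + 1) ^ k : ℕ) : ℝ) *
            (GkLat ℓ k a m2 (x + Pi.single μ 1) z - GkLat ℓ k a m2 x z) : ℝ) : ℂ) * f z‖ ^ p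
          ≤ c₂ ^ p * ∑ z ∈ S, ‖f z‖ ^ p := by
  obtain ⟨c₂, hc₂, h⟩ := GkLatD_apply_lp_le d ℓ hℓ amin aplus m2plus ha
  refine ⟨c₂, hc₂, ?_⟩
  intro k hk a m2 h1 h2 h3 h4 p hp μ S f
  exact lp_series_of_windows (fun _ => norm_nonneg _) hc₂.le
    (Finset.sum_nonneg fun _ _ => Real.rpow_nonneg (norm_nonneg _) _) (by linarith)
    fun Λ => h k hk a m2 h1 h2 h3 h4 p hp μ S Λ f

/-- **LEMMA 2.2 (2.17) ON THE DIAGONAL `q = p ∈ [1,∞[` FOR `G_k(0)∂^{η*}_μ`, `□ ↦ ηℤ^{d+1}`, `Ã = 0`, BY THE PRINTED ROUTE**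
(finite truncations): with `c₂` as in `GkLatD_apply_lp_le`, for every `k ≥ 1`, window point, real `p ≥ 1`, axis `μ`, finite
`S`, `Λ` and every complex `f`: `(Σ_{x∈Λ}|Σ_{z∈S} n(G_k(0)(x,z+e_μ) − G_k(0)(x,z))f(z)|^p)^{1/p} ≤ c₂·(Σ_{z∈S}|f(z)|^p)^{1/p}` —
the kernel `K′(x,z) = K(z,x)` (`GkLat_comm`) has the rows of `GkLat_weightedColD_le` and the columns of
`B4Thm19ZeroLattice.GkLat_weightedRowD_le`; `schur_riesz_thorin_counting` on `Λ × S` (the real-data statement in η-weighted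
norms is also `B4Lemma22ZeroLatticeLpLq.GkLatDadj_lpq_le` at `t = s`).
[cite: Balaban1983RegularityDecay, Lemma 2.2 (2.17) p.578 (third operator); proof p.583; dictionary (□ ↦ ηℤ^{d+1}, Ã = 0)] -/
theorem GkLat_adjDeriv_apply_lp_le (d ℓ : ℕ) (hℓ : 1 ≤ ℓ) (amin aplus m2plus : ℝ) (ha : 0 < amin) :
    ∃ c₂ : ℝ, 0 < c₂ ∧ ∀ (k : ℕ), 1 ≤ k → ∀ (a m2 : ℝ), amin ≤ a → a ≤ aplus → 0 ≤ m2 → m2 ≤ m2plus →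
      ∀ (p : ℝ), 1 ≤ p → ∀ (μ : Fin (d + 1)) (S Λ : Finset (Fin (d + 1) → ℤ)) (f : (Fin (d + 1) → ℤ) → ℂ),
        (∑ x ∈ Λ, ‖∑ z ∈ S, (((((ℓ + 1) ^ k : ℕ) : ℝ) *
            (GkLat ℓ k a m2 x (z + Pi.single μ 1) - GkLat ℓ k a m2 x z) : ℝ) : ℂ) * f z‖ ^ p) ^ p⁻¹
          ≤ c₂ * (∑ z ∈ S, ‖f z‖ ^ p) ^ p⁻¹ := by
  classical
  obtain ⟨δr, cr, hδr, hcr, hrow0⟩ := GkLat_weightedRowD_le d ℓ hℓ amin aplus m2plus ha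
  obtain ⟨δc, cc, hδc, hcc, hcol0⟩ := GkLat_weightedColD_le d ℓ hℓ amin aplus m2plus ha
  refine ⟨max cr cc, lt_max_of_lt_left hcr, ?_⟩
  intro k hk a m2 h1 h2 h3 h4 p hp μ S Λ f
  set c₂ : ℝ := max cr cc with hc₂
  have hc₂0 : 0 < c₂ := lt_max_of_lt_left hcr
  set Kf : (Fin (d + 1) → ℤ) → (Fin (d + 1) → ℤ) → ℝ := fun x z =>
    (((ℓ + 1) ^ k : ℕ) : ℝ) * (GkLat ℓ k a m2 x (z + Pi.single μ 1) - GkLat ℓ k a m2 x z) with hKf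
  -- rows of `K′`: the weighted column-differenced bound at the site `x`
  have hrowF : ∀ (x : Fin (d + 1) → ℤ) (F : Finset (Fin (d + 1) → ℤ)), ∑ z ∈ F, |Kf x z| ≤ c₂ :=
    fun x F => (sum_abs_le_of_weighted (fun z => weight_nonneg hδc.le _ (x - z))
      (hcol0 k hk a m2 h1 h2 h3 h4 μ x) F).trans (le_max_right _ _)
  -- columns of `K′`: by symmetry the rows of the row-differenced kernel at the site `z`
  have hcolF : ∀ (z : Fin (d + 1) → ℤ) (F : Finset (Fin (d + 1) → ℤ)), ∑ x ∈ F, |Kf x z| ≤ c₂ := by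
    intro z F
    have h0 := sum_abs_le_of_weighted (fun x => weight_nonneg hδr.le _ (z - x))
      (hrow0 k hk a m2 h1 h2 h3 h4 μ z) F
    refine (le_of_eq_of_le (Finset.sum_congr rfl fun x _ => ?_) h0).trans (le_max_left _ _)
    simp only [hKf]
    rw [GkLat_comm x (z + Pi.single μ 1), GkLat_comm x z]
  set K : ↥Λ → ↥S → ℂ := fun x z => ((Kf x.1 z.1 : ℝ) : ℂ) with hK
  have hrow : ∀ x : ↥Λ, ∑ z : ↥S, ‖K x z‖ ≤ c₂ := by
    intro x
    have := hrowF x.1 S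
    rw [← Finset.sum_coe_sort S] at this
    simpa only [hK, Complex.norm_real, Real.norm_eq_abs] using this
  have hcol : ∀ z : ↥S, ∑ x : ↥Λ, ‖K x z‖ ≤ c₂ := by
    intro z
    have := hcolF z.1 Λ
    rw [← Finset.sum_coe_sort Λ] at this
    simpa only [hK, Complex.norm_real, Real.norm_eq_abs] using this
  have H := schur_riesz_thorin_counting hc₂0.le hc₂0.le hrow hcol hp (fun z : ↥S => f z.1)
  have hcc' : c₂ ^ (1 - p⁻¹) * c₂ ^ p⁻¹ = c₂ := by
    rw [← Real.rpow_add hc₂0, sub_add_cancel, Real.rpow_one]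
  rw [hcc'] at H
  have hL : (∑ x : ↥Λ, ‖∑ z : ↥S, K x z * f z.1‖ ^ p)
      = ∑ x ∈ Λ, ‖∑ z ∈ S, ((Kf x z : ℝ) : ℂ) * f z‖ ^ p := by
    rw [← Finset.sum_coe_sort Λ]
    refine Finset.sum_congr rfl fun x _ => ?_
    rw [← Finset.sum_coe_sort S]
  have hR : (∑ z : ↥S, ‖f z.1‖ ^ p) = ∑ z ∈ S, ‖f z‖ ^ p := by
    rw [← Finset.sum_coe_sort S]
  rw [hL, hR] at H
  exact H

/-- **(2.17), `q = p`, FOR `G_k(0)∂^{η*}_μ`, SERIES FORM**: `Σ_{x∈ℤ^{d+1}}|(G_k(0)∂^{η*}_μf)(x)|^p ≤ c₂^p·Σ_z|f(z)|^p` for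
finitely supported `f` — i.e. `‖G_k(0)∂^{η*}_μf‖_{ℓ^p} ≤ c₂‖f‖_{ℓ^p}`, `1 ≤ p < ∞` (`p = ∞`: `GkLat_adjDeriv_apply_le`).
[cite: Balaban1983RegularityDecay, Lemma 2.2 (2.17) p.578 (third operator); proof p.583; dictionary (□ ↦ ηℤ^{d+1}, Ã = 0)] -/
theorem GkLat_adjDeriv_apply_lp_tsum_le (d ℓ : ℕ) (hℓ : 1 ≤ ℓ) (amin aplus m2plus : ℝ) (ha : 0 < amin) :
    ∃ c₂ : ℝ, 0 < c₂ ∧ ∀ (k : ℕ), 1 ≤ k → ∀ (a m2 : ℝ), amin ≤ a → a ≤ aplus → 0 ≤ m2 → m2 ≤ m2plus →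
      ∀ (p : ℝ), 1 ≤ p → ∀ (μ : Fin (d + 1)) (S : Finset (Fin (d + 1) → ℤ)) (f : (Fin (d + 1) → ℤ) → ℂ),
        (Summable fun x => ‖∑ z ∈ S, (((((ℓ + 1) ^ k : ℕ) : ℝ) *
            (GkLat ℓ k a m2 x (z + Pi.single μ 1) - GkLat ℓ k a m2 x z) : ℝ) : ℂ) * f z‖ ^ p) ∧
        ∑' x, ‖∑ z ∈ S, (((((ℓ + 1) ^ k : ℕ) : ℝ) *
            (GkLat ℓ k a m2 x (z + Pi.single μ 1) - GkLat ℓ k a m2 x z) : ℝ) : ℂ) * f z‖ ^ p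
          ≤ c₂ ^ p * ∑ z ∈ S, ‖f z‖ ^ p := by
  obtain ⟨c₂, hc₂, h⟩ := GkLat_adjDeriv_apply_lp_le d ℓ hℓ amin aplus m2plus ha
  refine ⟨c₂, hc₂, ?_⟩
  intro k hk a m2 h1 h2 h3 h4 p hp μ S f
  exact lp_series_of_windows (fun _ => norm_nonneg _) hc₂.le
    (Finset.sum_nonneg fun _ _ => Real.rpow_nonneg (norm_nonneg _) _) (by linarith)
    fun Λ => h k hk a m2 h1 h2 h3 h4 p hp μ S Λ f

/-! ## §4 Non-vacuity: the hypotheses are met (`d + 1 = 4`, `L = 2`, window `a ∈ [1/2, 2]`, `m² ∈ [0, 1]`) -/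

/-- (2.17), `q = p`, for `∂^η_μG_k(0)` at the physical dimension `d + 1 = 4`, `L = 2`. -/
example : ∃ c₂ : ℝ, 0 < c₂ ∧ ∀ (k : ℕ), 1 ≤ k → ∀ (a m2 : ℝ), (1 / 2 : ℝ) ≤ a → a ≤ 2 → 0 ≤ m2 → m2 ≤ 1 →
      ∀ (p : ℝ), 1 ≤ p → ∀ (μ : Fin (3 + 1)) (S Λ : Finset (Fin (3 + 1) → ℤ)) (f : (Fin (3 + 1) → ℤ) → ℂ),
        (∑ x ∈ Λ, ‖∑ z ∈ S, (((((1 + 1) ^ k : ℕ) : ℝ) *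
            (GkLat 1 k a m2 (x + Pi.single μ 1) z - GkLat 1 k a m2 x z) : ℝ) : ℂ) * f z‖ ^ p) ^ p⁻¹
          ≤ c₂ * (∑ z ∈ S, ‖f z‖ ^ p) ^ p⁻¹ :=
  GkLatD_apply_lp_le 3 1 le_rfl (1 / 2) 2 1 (by norm_num)

/-- the weighted column bound at `d + 1 = 4`, `L = 2`. -/
example : ∃ δ₀ c₀ : ℝ, 0 < δ₀ ∧ 0 < c₀ ∧ ∀ (k : ℕ), 1 ≤ k → ∀ (a m2 : ℝ), (1 / 2 : ℝ) ≤ a → a ≤ 2 → 0 ≤ m2 → m2 ≤ 1 →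
      ∀ (μ : Fin (3 + 1)) (x' : Fin (3 + 1) → ℤ) (F : Finset (Fin (3 + 1) → ℤ)),
        ∑ x ∈ F, |(((1 + 1) ^ k : ℕ) : ℝ) * (GkLat 1 k a m2 x' (x + Pi.single μ 1) - GkLat 1 k a m2 x' x)|
            * Real.exp (δ₀ * supNorm (x' - x) / (((1 + 1) ^ k : ℕ) : ℝ)) ≤ c₀ :=
  GkLat_weightedColD_le 3 1 le_rfl (1 / 2) 2 1 (by norm_num)

/-- the quantifier prefix is inhabited (`k = 1`, `a = 1`, `m² = 0`, `p = 2`, a bounded datum). -/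
example : (1 : ℕ) ≤ 1 ∧ (1 / 2 : ℝ) ≤ 1 ∧ (1 : ℝ) ≤ 2 ∧ (0 : ℝ) ≤ 0 ∧ (0 : ℝ) ≤ 1 ∧ (1 : ℝ) ≤ 2 ∧
    (∀ z : Fin (3 + 1) → ℤ, ‖(fun _ => (1 : ℂ)) z‖ ≤ 1) :=
  ⟨le_rfl, by norm_num, by norm_num, le_rfl, by norm_num, by norm_num, fun _ => by simp⟩

end

end Literature.MathematicalPhysics.QuantumFieldTheory.Balaban1983to89.B4Lemma22ZeroLatticeDeriv
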